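import Literature.Probability.RandomPlanarGeometry.HexSAWBridgeDecay
import HarnessLib

/-!
# Crux `HexConjecture` (stmt-CriticalPhenomena-0808), line `root-locality-replaces-loewner` (lead c8):
the Glazman–Manolescu triangle tail `triDl L` is strictly positive

Landing target:
`Summits/CriticalPhenomena/SAWScalingLimit/Theorems/SAWDevelopingMapHexConjectureTriDlPos.lean`
(`--supports stmt-CriticalPhenomena-0808`; registered stub `stub_triDl_pos`).

`HV.triDl L = Σ_{P ∈ leftWalks L} x_c^{ℓ(P)}` (`HV.triDl_eq`) is the `x_c`-mass of the self-avoiding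
mid-edge walks of the lattice triangle `T_L = HV.triV L` from the root mid-edge `a` that leave `T_L`
through its LEFT side (Glazman–Manolescu, §4.1, `Σ_K Δ^Δ_{L,K}`).  Every term is `≥ 0`
(`0 < x_c < 1`, `hexCriticalFugacity_pos_lt_one`) and one explicit walk lies in `leftWalks L`: the
straight walk along row `0` to the left,
`w, (0,0,false), (-1,0,true), (-1,0,false), …, (-L,0,false), (-L-1,0,true)`,
whose `k`-th vertex after `w` is `(-⌊(k+1)/2⌋, 0, k odd)` (`k = 0, …, 2L+1`); its inner vertices are
distinct cells of `T_L` and its final half-edge `((-L,0,false), (-L-1,0,true))` crosses the left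
side.  Hence `0 < x_c^{2L+1} ≤ triDl L`.
Sources: GlazmanManolescu2019 (§4.1, `Δ^Δ_{L,K}`), DuminilCopinSmirnov2012 (§3).
-/

noncomputable section

open scoped BigOperators Classical
open Finset
open Literature.Probability.RandomPlanarGeometry
open Literature.Probability.RandomPlanarGeometry.SAW
open Literature.Probability.RandomPlanarGeometry.SAW.HV

namespace Summit.CriticalPhenomena.SAWScalingLimit.Theorems.HexConjecture.RootLocality

/-- **An explicit walk of `T_L` to its left side**: for every `L` the straight row walk
`w :: [v 0, …, v (2L)] ++ [v (2L+1)]`, `v k = (-⌊(k+1)/2⌋, 0, k odd)`, belongs to `leftWalks L`, and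
it visits `2L + 1` vertices. [cite: GlazmanManolescu2019, §4.1 (Δ^Δ_{L,K})] -/
theorem triDlPos_exists_mem_leftWalks (L : ℕ) :
    ∃ P ∈ leftWalks L, mwLen P = 2 * L + 1 := by
  -- the row walk, kept opaque behind the equation `hv`
  obtain ⟨v, hv⟩ : ∃ v : ℕ → HV, v = fun k => (-(((k + 1) / 2 : ℕ) : ℤ), 0, decide (k % 2 = 1)) :=
    ⟨_, rfl⟩
  have hv_apply : ∀ k, v k = (-(((k + 1) / 2 : ℕ) : ℤ), 0, decide (k % 2 = 1)) := fun k => by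
    rw [hv]
  -- consecutive row vertices are adjacent
  have hadj : ∀ k, hvGraph.Adj (v k) (v (k + 1)) := by
    intro k
    rw [hv_apply, hv_apply, hvGraph_adj, AdjRel]
    rcases Nat.even_or_odd k with ⟨j, rfl⟩ | ⟨j, rfl⟩
    · have h1 : ¬ (j + j) % 2 = 1 := by omega
      have h2 : (j + j + 1) % 2 = 1 := by omega
      have h3 : ((j + j + 1) / 2 : ℕ) = j := by omega
      have h4 : ((j + j + 1 + 1) / 2 : ℕ) = j + 1 := by omega
      simp [h1, h2, h3, h4]; omega
    · have h1 : (2 * j + 1) % 2 = 1 := by omega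
      have h2 : ¬ (2 * j + 1 + 1) % 2 = 1 := by omega
      have h3 : ((2 * j + 1 + 1) / 2 : ℕ) = j + 1 := by omega
      have h4 : ((2 * j + 1 + 1 + 1) / 2 : ℕ) = j + 1 := by omega
      simp [h1, h2, h3, h4]
  -- the row walk never returns
  have hinj : Function.Injective v := by
    intro a b h
    rw [hv_apply, hv_apply] at h
    simp only [Prod.mk.injEq, neg_inj, Nat.cast_inj, decide_eq_decide] at h
    omega
  -- the first `2L + 1` row vertices are cells of `T_L`
  have hmemV : ∀ k, k ≤ 2 * L → v k ∈ triV L := by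
    intro k hk
    rw [hv_apply, mem_triV_iff]
    by_cases hk2 : k % 2 = 1
    · simp [hk2, bit]; omega
    · simp [hk2, bit]; omega
  -- the inner list and the exit vertex
  set l : List HV := (List.range (2 * L + 1)).map v with hl_def
  set u : HV := v (2 * L + 1) with hu_def
  have hl : l ≠ [] := by simp [hl_def]
  have hlast : l.getLast hl = v (2 * L) := by
    simp only [hl_def, List.getLast_map, List.getLast_range]; simp
  have hhead : l.head? = some hvOrigin := by
    simp only [hl_def, List.range_succ_eq_map, List.map_cons, List.head?_cons, hv_apply]
    simp [hvOrigin]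
  have hmem_l : ∀ x ∈ l, ∃ k < 2 * L + 1, v k = x := by
    intro x hx
    simpa [hl_def, List.mem_map, List.mem_range] using hx
  have hu_notin : u ∉ l := by
    intro h
    obtain ⟨k, hk, hkx⟩ := hmem_l u h
    have := hinj hkx
    omega
  have hu_ne_w : u ≠ wOut := by
    rw [hu_def, hv_apply, wOut]; simp
  -- it is a self-avoiding mid-edge walk of `T_L`
  have hW : IsMidWalk (triV L) (wOut :: (l ++ [u])) := by
    refine (isMidWalk_cons_append_iff _ hl u).2 ⟨?_, hhead, ?_, ?_, ?_, ?_⟩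
    · rw [hl_def, List.isChain_map, List.isChain_range_succ]
      intro m _
      exact hadj m
    · rw [hlast, hu_def]
      exact hadj (2 * L)
    · intro x hx
      obtain ⟨k, hk, rfl⟩ := hmem_l x hx
      exact hmemV k (by omega)
    · rw [hl_def]
      exact (List.nodup_range).map hinj
    · rcases prevOf_mem l with h | h
      · rw [h]; exact hu_ne_w
      · intro hu; rw [hu] at hu_notin; exact hu_notin h
  -- its final half-edge crosses the left side
  have hleft : IsLeftDart L (finalDart (wOut :: (l ++ [u]))) := by
    rw [finalDart_cons_append hl u, hlast, hu_def, hv_apply, hv_apply]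
    have e1 : ((2 * L + 1) / 2 : ℕ) = L := by omega
    have e2 : ((2 * L + 1 + 1) / 2 : ℕ) = L + 1 := by omega
    have e4 : (2 * L + 1) % 2 = 1 := by omega
    refine ⟨?_, ?_, ?_⟩
    · simp [e1]
    · simp
    · simp [e1, e2, e4]; omega
  refine ⟨wOut :: (l ++ [u]), ?_, ?_⟩
  · rw [leftWalks, Finset.mem_filter, mem_midWalks_iff]
    exact ⟨hW, hleft⟩
  · rw [mwLen_cons_append, hl_def, List.length_map, List.length_range]

/-- **The Glazman–Manolescu triangle tail is positive**: `0 < triDl L = Σ_K Δ^Δ_{L,K}` for every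
`L` — all terms `x_c^{ℓ(P)}` are nonnegative and the straight row walk to the left side contributes
`x_c^{2L+1} > 0`. [cite: GlazmanManolescu2019, §4.1 (Δ^Δ_{L,K})] -/
theorem stub_triDl_pos : ∀ (L : ℕ), 0 < Literature.Probability.RandomPlanarGeometry.SAW.HV.triDl L := by
  intro L
  obtain ⟨P, hP, -⟩ := triDlPos_exists_mem_leftWalks L
  rw [triDl_eq]
  calc (0 : ℝ) < hexCriticalFugacity ^ mwLen P := pow_pos hexCriticalFugacity_pos_lt_one.1 _
    _ ≤ ∑ Q ∈ leftWalks L, hexCriticalFugacity ^ mwLen Q :=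
      Finset.single_le_sum (f := fun Q => hexCriticalFugacity ^ mwLen Q)
        (fun _ _ => pow_nonneg hexCriticalFugacity_pos_lt_one.1.le _) hP

/-- **Quantitative form**: `x_c^{2L+1} ≤ triDl L` (the row walk alone).
[cite: GlazmanManolescu2019, §4.1 (Δ^Δ_{L,K})] -/
theorem triDlPos_pow_le_triDl (L : ℕ) : hexCriticalFugacity ^ (2 * L + 1) ≤ triDl L := by
  obtain ⟨P, hP, hlen⟩ := triDlPos_exists_mem_leftWalks L
  rw [triDl_eq, ← hlen]
  exact Finset.single_le_sum (f := fun Q => hexCriticalFugacity ^ mwLen Q)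
    (fun _ _ => pow_nonneg hexCriticalFugacity_pos_lt_one.1.le _) hP

end Summit.CriticalPhenomena.SAWScalingLimit.Theorems.HexConjecture.RootLocality
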